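import Mathlib

/-!
# The twisted 3-cube lemma of the one-mixed-arm block (blind cell PercRepro2, night-4 g16,
2026-08-26; proofs/NIGHT4-G12.md §5′(b), proofs/NIGHT4-G16.md §6)

The abstract combinatorial core of the one-mixed-arm block of NIGHT4-G12.md §5′: a point of the
3-cube is `(x, a, ε)` — `x` = the coarse arm of `u` red, `a` = the h-piece of the mixed arm red,
`ε` = the dropped piece sealed on `u`'s side — with the red edge set `ER (x, a) = {X | x} ∪ {A | a}`
on the two atoms `X = 0`, `A = 1` and the blue edge set `EB (x, a) = {X | ¬x} ∪ {A | ¬a}`; the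
core cube takes the two points `(true, false, true)` and `(false, true, true)`.  **For every lower
set `Q` of the cube and every up-set `𝓔` of the atoms, `Q` minus the two core points satisfies
the rigid counting inequality** (`mixedCube_card_le`; all 20 lower sets × all 6 up-sets, by
`decide`).  The far arms (further product coordinates) are NOT included: the real block carries
them, and the lemma with extra coordinates is the planners' open item (random tests only in G12).
-/

namespace Summit.Ventures.PercRepro2

namespace MixedCube

/-- A point of the twisted 3-cube: `(x, a, ε)`. -/
abbrev Pt := Bool × Bool × Bool

/-- The red edge set on the two atoms (`0` = the coarse arm `X`, `1` = the h-piece `A`). -/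
def ER (p : Pt) : Finset (Fin 2) :=
  (if p.1 then {0} else ∅) ∪ (if p.2.1 then {1} else ∅)

/-- The blue edge set: the complementary atoms. -/
def EB (p : Pt) : Finset (Fin 2) :=
  (if p.1 then ∅ else {0}) ∪ (if p.2.1 then ∅ else {1})

/-- The two points of the core cube inside the twisted cube. -/
def corePts : Finset Pt := {(true, false, true), (false, true, true)}

/-- A lower set of the cube (product order on `Bool`). -/
def IsLowerPts (Q : Finset Pt) : Prop := ∀ p ∈ Q, ∀ q : Pt, q ≤ p → q ∈ Q

/-- An up-set of atom sets. -/
def IsUpperAtoms (𝓔 : Finset (Finset (Fin 2))) : Prop :=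
  ∀ F ∈ 𝓔, ∀ G : Finset (Fin 2), F ⊆ G → G ∈ 𝓔

/-- `IsLowerPts` is decidable (a finite check). -/
instance instDecidableIsLowerPts (Q : Finset Pt) : Decidable (IsLowerPts Q) := by
  unfold IsLowerPts; infer_instance

/-- `IsUpperAtoms` is decidable (a finite check). -/
instance instDecidableIsUpperAtoms (𝓔 : Finset (Finset (Fin 2))) : Decidable (IsUpperAtoms 𝓔) := by
  unfold IsUpperAtoms; infer_instance

/-- **The twisted 3-cube lemma**: on every lower set of the cube (product order on `Bool`) minus
the two core points, for every up-set of atom sets, the red count is at most the blue count. -/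
theorem mixedCube_card_le : ∀ Q : Finset Pt, IsLowerPts Q →
    ∀ 𝓔 : Finset (Finset (Fin 2)), IsUpperAtoms 𝓔 →
      ((Q \ corePts).filter fun p => ER p ∈ 𝓔).card ≤
        ((Q \ corePts).filter fun p => EB p ∈ 𝓔).card := by
  decide +kernel

end MixedCube

end Summit.Ventures.PercRepro2
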